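import Summits.ABC.ABC.Theses.IneffectiveSubspace

/-!
# `UniformSadicTowerFour` (stmt-ABC-14937), line `flat-steep-split`: the `θ`-dial of the heavy child is monotone

For the HEAVY-CORE child of the crux (S non-empty, every `p ∈ S` θ-heavy: `c^θ ≤ p^{v_p(abc)}`), the
statement at a parameter `θ` implies the statement at every `θ' ≥ θ` (`heavyAt_mono`): heaviness at `θ'`
implies heaviness at `θ` because `c ≥ 1`.  So the content of HEAVY-CORE is its limit `θ → 0⁺`
(`heavyCore_iff_small`: it suffices to know it for all `θ ≤ θ₀`, any fixed `θ₀ ∈ (0, 1]`), while its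
boundary `θ = 1` (uniform prime-power cell, `HeavyAtOne`) is its WEAKEST instance.
-/

-- `Summit.<Summit>.<Problem>` is the mandated summit-side namespace (CONVENTIONS §2); for the
-- single-conjunct summit `ABC` the two coincide, so the duplicate `ABC.ABC` is deliberate.
set_option linter.dupNamespace false

namespace Summit.ABC.ABC.Theorems.UniformSadicTowerFour.HeavyPlaces

open Literature.NumberTheory.DiophantineGeometry (IsABCTriple)
open scoped BigOperators

/-- **Monotonicity of the heavy dial** (registered stub `heavyAt_mono`): the heavy-places statement at
`θ` implies it at every `θ' ≥ θ`. [folklore] -/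
theorem heavyAt_mono {θ θ' : ℝ} (hθθ' : θ ≤ θ')
    (h : ∀ ε : ℝ, 0 < ε → ∃ C : ℝ, 0 < C ∧ ∀ S : Finset ℕ, S.Nonempty →
      (∀ p ∈ S, Nat.Prime p) → ∀ a b c : ℕ, IsABCTriple a b c →
      (∀ p ∈ S, (c : ℝ) ^ θ ≤ ((p ^ (a * b * c).factorization p : ℕ) : ℝ)) →
      (c : ℝ) < C * ((((∏ p ∈ S, p) *
        ∏ p ∈ (a * b * c).primeFactors \ S, p ^ (((a * b * c).factorization p + 3) / 4) : ℕ) : ℝ)) ^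
          (1 + ε)) :
    ∀ ε : ℝ, 0 < ε → ∃ C : ℝ, 0 < C ∧ ∀ S : Finset ℕ, S.Nonempty →
      (∀ p ∈ S, Nat.Prime p) → ∀ a b c : ℕ, IsABCTriple a b c →
      (∀ p ∈ S, (c : ℝ) ^ θ' ≤ ((p ^ (a * b * c).factorization p : ℕ) : ℝ)) →
      (c : ℝ) < C * ((((∏ p ∈ S, p) *
        ∏ p ∈ (a * b * c).primeFactors \ S, p ^ (((a * b * c).factorization p + 3) / 4) : ℕ) : ℝ)) ^
          (1 + ε) := by
  intro ε hε
  obtain ⟨C, hC, hS⟩ := h ε hε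
  refine ⟨C, hC, fun S hSne hSp a b c habc hheavy => hS S hSne hSp a b c habc fun p hp => ?_⟩
  have hc1 : (1 : ℝ) ≤ c := by
    obtain ⟨ha, hb, hsum, _⟩ := habc
    exact_mod_cast (show 1 ≤ c by omega)
  exact (Real.rpow_le_rpow_of_exponent_le hc1 hθθ').trans (hheavy p hp)

/-- **HEAVY-CORE is its small-`θ` limit**: for any `θ₀ ∈ (0, 1]`, the core statement for all
`θ ∈ (0, 1]` is equivalent to the statement for all `θ ∈ (0, θ₀]`. [folklore] -/
theorem heavyCore_iff_small {θ₀ : ℝ} (hθ₀ : 0 < θ₀) (hθ₀1 : θ₀ ≤ 1) :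
    (∀ θ : ℝ, 0 < θ → θ ≤ 1 → ∀ ε : ℝ, 0 < ε → ∃ C : ℝ, 0 < C ∧ ∀ S : Finset ℕ, S.Nonempty →
      (∀ p ∈ S, Nat.Prime p) → ∀ a b c : ℕ, IsABCTriple a b c →
      (∀ p ∈ S, (c : ℝ) ^ θ ≤ ((p ^ (a * b * c).factorization p : ℕ) : ℝ)) →
      (c : ℝ) < C * ((((∏ p ∈ S, p) *
        ∏ p ∈ (a * b * c).primeFactors \ S, p ^ (((a * b * c).factorization p + 3) / 4) : ℕ) : ℝ)) ^
          (1 + ε)) ↔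
    (∀ θ : ℝ, 0 < θ → θ ≤ θ₀ → ∀ ε : ℝ, 0 < ε → ∃ C : ℝ, 0 < C ∧ ∀ S : Finset ℕ, S.Nonempty →
      (∀ p ∈ S, Nat.Prime p) → ∀ a b c : ℕ, IsABCTriple a b c →
      (∀ p ∈ S, (c : ℝ) ^ θ ≤ ((p ^ (a * b * c).factorization p : ℕ) : ℝ)) →
      (c : ℝ) < C * ((((∏ p ∈ S, p) *
        ∏ p ∈ (a * b * c).primeFactors \ S, p ^ (((a * b * c).factorization p + 3) / 4) : ℕ) : ℝ)) ^
          (1 + ε)) := by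
  constructor
  · intro h θ hθ hθle
    exact h θ hθ (hθle.trans hθ₀1)
  · intro h θ hθ _
    by_cases hle : θ ≤ θ₀
    · exact h θ hθ hle
    · exact heavyAt_mono (not_le.mp hle).le (h θ₀ hθ₀ le_rfl)

end Summit.ABC.ABC.Theorems.UniformSadicTowerFour.HeavyPlaces
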